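import Mathlib
import Summits.AnomalousDissipation.AnomalousDissipation.Theorems.DyadicWallCascadeHalfSpaceHierarchySlabExtension

/-!
# Stub `stub_localJunctionTransfer` of the line `bernoulli-surface-topology` — crux
# `DyadicWallCascade.HalfSpaceHierarchy` (item stmt-AnomalousDissipation-18627): `ℤ²`-periodization of a local junction

Sorry-free discharge of the registered TOOL stub `stub_localJunctionTransfer` of the lead's skeleton
(`Cruxes/HalfSpaceHierarchy/Lines/bernoulli_surface_topology.lean`, §1).

**Statement.**  A *local junction in rest fluid* — an entire smooth steady Euler conduit `(g, pg)` vanishing outside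
the open column `(2δ, 1-2δ)² × ℝ` (`0 < δ < 1/4`), with zero mass flux and energy flux `F ≠ 0` through the unit square
of `{z = 0}`, and a cell solution `(u, p)` on the slab `{1-η < z < 2+η}` (`0 < η < 1/2`; divergence free and steady
Euler on the open band `{1 < z < 2}`) vanishing near the cell walls `{x ≤ δ} ∪ {x ≥ 1-δ} ∪ {y ≤ δ} ∪ {y ≥ 1-δ}`, equal
to `(g, pg)` on the top collar and to the sum of the FOUR half-scale children `(g, pg) (2X - n)`, `n ∈ {0, e₀, e₁, e₀+e₁}`,
on the bottom collar — yields a *periodic cell junction* `(G, PG, U, P, F, η)`: verbatim the body of the lead's open stub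
`stub_cellJunction` (= the antecedent of the landed `stub_cellJunctionTransfer`), i.e. the same clauses with
`ℤ²`-periodicity in `x, y` in place of the margins, top collar `U = G`, bottom collar `U = G (2 •)`.

**Proof (bookkeeping, no PDE).**  Witnesses: the periodizations `g ∘ T`, `pg ∘ T`, `u ∘ T`, `p ∘ T` with the SAME
`F, η`, where `T X := X - ⌊X₀⌋ e₀ - ⌊X₁⌋ e₁` (it preserves the height `X₂`; below `T` is an abstract map with this
defining identity).  `T` is invariant under integer horizontal translations (`cellPeriodize_shift`) — periodicity.
LOCAL FORM (`cellPeriodize_eventuallyEq`): if `f` vanishes at the points of a height band with `x ≤ m ∨ x ≥ 1-m ∨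
y ≤ m ∨ y ≥ 1-m` (`m > 0`), then near each point `X` of the band `f ∘ T = f (· - (X - T X))` (on
`{X_i - m < Y_i < ⌊X_i⌋ + 1}` either both floors of `Y` are those of `X`, or both sides vanish by the margin); hence
smoothness (`cellPeriodize_contDiffAt`) and `fderiv (f ∘ T) X = fderiv f (T X)` (`cellPeriodize_fderiv`), so
divergence, Euler and the collars are read off at `T X`.  TRACE (`cellPeriodize_trace`): on `[0,1]²`,
`f (T (x,y,z)) = f (x,y,z)` (interior `T = id`, edges: both vanish) — the flux clauses.  CHILDREN
(`cellPeriodize_fold`, `cellPeriodize_children`): for `Z = 2 • T X` exactly one of `Z - n` is `T Z = T (2 • X)`, the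
other three lie in the margin — the bottom collar.  Only `0 < δ` is used (not `δ < 1/4`).  Folklore.
-/

-- `Summit.<Summit>.<Problem>` is the tree's mandated summit-side namespace (CONVENTIONS §2); for this
-- single-conjunct summit the two coincide, so the duplicate is deliberate.
set_option linter.dupNamespace false

open scoped Topology InnerProductSpace
open MeasureTheory Filter Set

noncomputable section

namespace Summit.AnomalousDissipation.AnomalousDissipation.Theorems.HalfSpaceHierarchy

/-- Coordinates of a horizontal translate `Y - (a e₀ + b e₁)`: `(Y₀ - a, Y₁ - b, Y₂)`. -/
theorem cellPeriodize_coord (Y : EuclideanSpace ℝ (Fin 3)) (a b : ℝ) :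
    (Y - (a • EuclideanSpace.single 0 (1 : ℝ) + b • EuclideanSpace.single 1 (1 : ℝ)) : EuclideanSpace ℝ (Fin 3)) 0 =
      Y 0 - a ∧
    (Y - (a • EuclideanSpace.single 0 (1 : ℝ) + b • EuclideanSpace.single 1 (1 : ℝ)) : EuclideanSpace ℝ (Fin 3)) 1 =
      Y 1 - b ∧
    (Y - (a • EuclideanSpace.single 0 (1 : ℝ) + b • EuclideanSpace.single 1 (1 : ℝ)) : EuclideanSpace ℝ (Fin 3)) 2 =
      Y 2 := by
  refine ⟨?_, ?_, ?_⟩ <;> simp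

section Periodize

/-! ### The reduction `T X = X - ⌊X₀⌋ e₀ - ⌊X₁⌋ e₁` into the unit column (an abstract map with this identity) -/

variable {T : EuclideanSpace ℝ (Fin 3) → EuclideanSpace ℝ (Fin 3)}
  (hT : ∀ X : EuclideanSpace ℝ (Fin 3), T X = X - ((⌊X 0⌋ : ℝ) • EuclideanSpace.single 0 (1 : ℝ) +
    (⌊X 1⌋ : ℝ) • EuclideanSpace.single 1 (1 : ℝ)))
include hT

/-- `T` is invariant under integer horizontal translations: `T (X + k e₀ + l e₁) = T X` (`k, l ∈ ℤ`). -/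
theorem cellPeriodize_shift (X : EuclideanSpace ℝ (Fin 3)) (k l : ℤ) :
    T (X + ((k : ℝ) • EuclideanSpace.single 0 (1 : ℝ) + (l : ℝ) • EuclideanSpace.single 1 (1 : ℝ))) = T X := by
  have h0 : (X + ((k : ℝ) • EuclideanSpace.single 0 (1 : ℝ) + (l : ℝ) • EuclideanSpace.single 1 (1 : ℝ)) :
      EuclideanSpace ℝ (Fin 3)) 0 = X 0 + k := by simp
  have h1 : (X + ((k : ℝ) • EuclideanSpace.single 0 (1 : ℝ) + (l : ℝ) • EuclideanSpace.single 1 (1 : ℝ)) :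
      EuclideanSpace ℝ (Fin 3)) 1 = X 1 + l := by simp
  rw [hT, hT X, h0, h1, Int.floor_add_intCast, Int.floor_add_intCast]
  push_cast
  module

/-- **Local form.**  If `f` vanishes at the points of the height band `{Y₂ ∈ S}` (`S` open) whose first or second
coordinate is `≤ m` or `≥ 1 - m` (`m > 0`), then near every point `X` of the band the periodization `f ∘ T` IS the
translate `f (· - (X - T X))` by the constant vector `X - T X = ⌊X₀⌋ e₀ + ⌊X₁⌋ e₁`. -/
theorem cellPeriodize_eventuallyEq {α : Type*} [Zero α] (f : EuclideanSpace ℝ (Fin 3) → α)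
    {S : Set ℝ} (hS : IsOpen S) {m : ℝ} (hm : 0 < m)
    (hf : ∀ Y : EuclideanSpace ℝ (Fin 3), Y 2 ∈ S → (Y 0 ≤ m ∨ 1 - m ≤ Y 0 ∨ Y 1 ≤ m ∨ 1 - m ≤ Y 1) → f Y = 0)
    {X : EuclideanSpace ℝ (Fin 3)} (hX : X 2 ∈ S) :
    (fun Y : EuclideanSpace ℝ (Fin 3) => f (T Y)) =ᶠ[𝓝 X]
      fun Y : EuclideanSpace ℝ (Fin 3) => f (Y - (X - T X)) := by
  have hc : ∀ i : Fin 3, Continuous fun Y : EuclideanSpace ℝ (Fin 3) => Y i := fun i =>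
    (continuous_apply i).comp (PiLp.continuous_ofLp 2 _)
  have h2 : ∀ᶠ Y in 𝓝 X, Y 2 ∈ S := (hc 2).continuousAt.eventually_mem (hS.mem_nhds hX)
  have h0 : ∀ᶠ Y in 𝓝 X, Y 0 ∈ Ioo (X 0 - m) ((⌊X 0⌋ : ℝ) + 1) :=
    (hc 0).continuousAt.eventually_mem (Ioo_mem_nhds (by linarith) (Int.lt_floor_add_one _))
  have h1 : ∀ᶠ Y in 𝓝 X, Y 1 ∈ Ioo (X 1 - m) ((⌊X 1⌋ : ℝ) + 1) :=
    (hc 1).continuousAt.eventually_mem (Ioo_mem_nhds (by linarith) (Int.lt_floor_add_one _))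
  have hcX : X - T X = (⌊X 0⌋ : ℝ) • EuclideanSpace.single 0 (1 : ℝ) +
      (⌊X 1⌋ : ℝ) • EuclideanSpace.single 1 (1 : ℝ) := by
    rw [hT, sub_sub_cancel]
  filter_upwards [h2, h0, h1] with Y hY2 hY0 hY1
  rw [hcX]
  have hX0 := Int.floor_le (X 0)
  have hX1 := Int.floor_le (X 1)
  -- a horizontal translate of `Y` in the margin is a zero of `f`
  have hR : ∀ a b : ℝ, (Y 0 - a ≤ m ∨ 1 - m ≤ Y 0 - a ∨ Y 1 - b ≤ m ∨ 1 - m ≤ Y 1 - b) →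
      f (Y - (a • EuclideanSpace.single 0 (1 : ℝ) + b • EuclideanSpace.single 1 (1 : ℝ))) = 0 := by
    intro a b h
    refine hf _ ?_ ?_
    · rw [(cellPeriodize_coord Y a b).2.2]
      exact hY2
    · rw [(cellPeriodize_coord Y a b).1, (cellPeriodize_coord Y a b).2.1]
      exact h
  by_cases hk0 : (⌊X 0⌋ : ℝ) ≤ Y 0
  · by_cases hk1 : (⌊X 1⌋ : ℝ) ≤ Y 1
    · -- both floors of `Y` are those of `X`: `T Y` is the translate
      rw [hT, Int.floor_eq_iff.2 ⟨hk0, hY0.2⟩, Int.floor_eq_iff.2 ⟨hk1, hY1.2⟩]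
    · -- `Y₁ < ⌊X₁⌋`: both sides vanish
      push Not at hk1
      have hle : (⌊Y 1⌋ : ℝ) + 1 ≤ ⌊X 1⌋ := by exact_mod_cast Int.add_one_le_iff.2 (Int.floor_lt.2 hk1)
      rw [hT, hR (⌊Y 0⌋) (⌊Y 1⌋) (Or.inr (Or.inr (Or.inr (by linarith [hY1.1])))),
        hR (⌊X 0⌋) (⌊X 1⌋) (Or.inr (Or.inr (Or.inl (by linarith))))]
  · -- `Y₀ < ⌊X₀⌋`: both sides vanish
    push Not at hk0
    have hle : (⌊Y 0⌋ : ℝ) + 1 ≤ ⌊X 0⌋ := by exact_mod_cast Int.add_one_le_iff.2 (Int.floor_lt.2 hk0)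
    rw [hT, hR (⌊Y 0⌋) (⌊Y 1⌋) (Or.inr (Or.inl (by linarith [hY0.1]))),
      hR (⌊X 0⌋) (⌊X 1⌋) (Or.inl (by linarith))]

/-- **Smoothness transfer.**  Under the margin hypothesis, `f ∘ T` is `C^n` at a point `X` of the band as soon as
`f` is `C^n` at `T X`. -/
theorem cellPeriodize_contDiffAt {F' : Type*} [NormedAddCommGroup F'] [NormedSpace ℝ F']
    (f : EuclideanSpace ℝ (Fin 3) → F') {S : Set ℝ} (hS : IsOpen S) {m : ℝ} (hm : 0 < m)
    (hf : ∀ Y : EuclideanSpace ℝ (Fin 3), Y 2 ∈ S → (Y 0 ≤ m ∨ 1 - m ≤ Y 0 ∨ Y 1 ≤ m ∨ 1 - m ≤ Y 1) → f Y = 0)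
    {X : EuclideanSpace ℝ (Fin 3)} (hX : X 2 ∈ S) {n : WithTop ℕ∞} (hfX : ContDiffAt ℝ n f (T X)) :
    ContDiffAt ℝ n (fun Y : EuclideanSpace ℝ (Fin 3) => f (T Y)) X := by
  have ht : ContDiffAt ℝ n (fun Y : EuclideanSpace ℝ (Fin 3) => Y - (X - T X)) X :=
    contDiffAt_id.sub contDiffAt_const
  have hy : ContDiffAt ℝ n f (X - (X - T X)) := by rwa [sub_sub_cancel]
  exact (ContDiffAt.comp (g := f) X hy ht).congr_of_eventuallyEq (cellPeriodize_eventuallyEq hT f hS hm hf hX)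

/-- **Derivative transfer.**  `fderiv (f ∘ T) X = fderiv f (T X)` at every point of the band. -/
theorem cellPeriodize_fderiv {F' : Type*} [NormedAddCommGroup F'] [NormedSpace ℝ F']
    (f : EuclideanSpace ℝ (Fin 3) → F') {S : Set ℝ} (hS : IsOpen S) {m : ℝ} (hm : 0 < m)
    (hf : ∀ Y : EuclideanSpace ℝ (Fin 3), Y 2 ∈ S → (Y 0 ≤ m ∨ 1 - m ≤ Y 0 ∨ Y 1 ≤ m ∨ 1 - m ≤ Y 1) → f Y = 0)
    {X : EuclideanSpace ℝ (Fin 3)} (hX : X 2 ∈ S) :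
    fderiv ℝ (fun Y : EuclideanSpace ℝ (Fin 3) => f (T Y)) X = fderiv ℝ f (T X) := by
  rw [(cellPeriodize_eventuallyEq hT f hS hm hf hX).fderiv_eq, fderiv_comp_sub, sub_sub_cancel]

/-- **Trace.**  On the closed unit square `[0,1]²` (any height) the periodization of a function vanishing near the
cell walls is the function itself: in the interior `T = id`, on the edges `x = 1`, `y = 1` both sides vanish. -/
theorem cellPeriodize_trace {α : Type*} [Zero α] (f : EuclideanSpace ℝ (Fin 3) → α) {m : ℝ} (hm : 0 ≤ m)
    (hf : ∀ Y : EuclideanSpace ℝ (Fin 3), (Y 0 ≤ m ∨ 1 - m ≤ Y 0 ∨ Y 1 ≤ m ∨ 1 - m ≤ Y 1) → f Y = 0)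
    {x y : ℝ} (hx : x ∈ Icc (0 : ℝ) 1) (hy : y ∈ Icc (0 : ℝ) 1) (z : ℝ) :
    f (T !₂[x, y, z]) = f !₂[x, y, z] := by
  have p0 : (!₂[x, y, z] : EuclideanSpace ℝ (Fin 3)) 0 = x := by simp
  have p1 : (!₂[x, y, z] : EuclideanSpace ℝ (Fin 3)) 1 = y := by simp
  rw [hT, p0, p1]
  rcases eq_or_lt_of_le hx.2 with hx1 | hx1
  · -- edge `x = 1`
    subst hx1
    rw [hf !₂[1, y, z] (Or.inr (Or.inl (by rw [p0]; linarith))), hf _ (Or.inl ?_)]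
    rw [(cellPeriodize_coord _ _ _).1, p0]
    simp [hm]
  · rcases eq_or_lt_of_le hy.2 with hy1 | hy1
    · -- edge `y = 1`
      subst hy1
      rw [hf !₂[x, 1, z] (Or.inr (Or.inr (Or.inr (by rw [p1]; linarith)))), hf _ (Or.inr (Or.inr (Or.inl ?_)))]
      rw [(cellPeriodize_coord _ _ _).2.1, p1]
      simp [hm]
    · -- interior: both floors vanish
      rw [Int.floor_eq_zero_iff.2 ⟨hx.1, hx1⟩, Int.floor_eq_zero_iff.2 ⟨hy.1, hy1⟩]
      simp

/-- **Folding the four children.**  For a point `Z` with `Z₀, Z₁ ∈ [0, 2)` exactly one of `Z`, `Z - e₀`, `Z - e₁`,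
`Z - e₀ - e₁` is the reduced point `T Z`; the other three lie in the margin, where `f` vanishes. -/
theorem cellPeriodize_fold {α : Type*} [AddMonoid α] (f : EuclideanSpace ℝ (Fin 3) → α) {m : ℝ} (hm : 0 ≤ m)
    (hf : ∀ Y : EuclideanSpace ℝ (Fin 3), (Y 0 ≤ m ∨ 1 - m ≤ Y 0 ∨ Y 1 ≤ m ∨ 1 - m ≤ Y 1) → f Y = 0)
    {Z : EuclideanSpace ℝ (Fin 3)} (h0 : 0 ≤ Z 0) (h0' : Z 0 < 2) (h1 : 0 ≤ Z 1) (h1' : Z 1 < 2) :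
    f Z + f (Z - EuclideanSpace.single 0 (1 : ℝ)) + f (Z - EuclideanSpace.single 1 (1 : ℝ)) +
        f (Z - EuclideanSpace.single 0 (1 : ℝ) - EuclideanSpace.single 1 (1 : ℝ)) = f (T Z) := by
  have c00 : (Z - EuclideanSpace.single 0 (1 : ℝ) : EuclideanSpace ℝ (Fin 3)) 0 = Z 0 - 1 := by simp
  have c01 : (Z - EuclideanSpace.single 0 (1 : ℝ) : EuclideanSpace ℝ (Fin 3)) 1 = Z 1 := by simp
  have c10 : (Z - EuclideanSpace.single 1 (1 : ℝ) : EuclideanSpace ℝ (Fin 3)) 0 = Z 0 := by simp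
  have c11 : (Z - EuclideanSpace.single 1 (1 : ℝ) : EuclideanSpace ℝ (Fin 3)) 1 = Z 1 - 1 := by simp
  have c20 : (Z - EuclideanSpace.single 0 (1 : ℝ) - EuclideanSpace.single 1 (1 : ℝ) : EuclideanSpace ℝ (Fin 3)) 0 =
      Z 0 - 1 := by simp
  have c21 : (Z - EuclideanSpace.single 0 (1 : ℝ) - EuclideanSpace.single 1 (1 : ℝ) : EuclideanSpace ℝ (Fin 3)) 1 =
      Z 1 - 1 := by simp
  rw [hT Z]
  rcases lt_or_ge (Z 0) 1 with hz0 | hz0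
  · have f0 : ⌊Z 0⌋ = 0 := Int.floor_eq_zero_iff.2 ⟨h0, hz0⟩
    have v1 : f (Z - EuclideanSpace.single 0 (1 : ℝ)) = 0 := hf _ (Or.inl (by rw [c00]; linarith))
    have v3 : f (Z - EuclideanSpace.single 0 (1 : ℝ) - EuclideanSpace.single 1 (1 : ℝ)) = 0 :=
      hf _ (Or.inl (by rw [c20]; linarith))
    rcases lt_or_ge (Z 1) 1 with hz1 | hz1
    · have f1 : ⌊Z 1⌋ = 0 := Int.floor_eq_zero_iff.2 ⟨h1, hz1⟩
      have v2 : f (Z - EuclideanSpace.single 1 (1 : ℝ)) = 0 :=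
        hf _ (Or.inr (Or.inr (Or.inl (by rw [c11]; linarith))))
      rw [v1, v2, v3, f0, f1]
      simp
    · have f1 : ⌊Z 1⌋ = 1 := by rw [Int.floor_eq_iff]; push_cast; exact ⟨hz1, by linarith⟩
      have v0 : f Z = 0 := hf _ (Or.inr (Or.inr (Or.inr (by linarith))))
      rw [v0, v1, v3, f0, f1]
      simp
  · have f0 : ⌊Z 0⌋ = 1 := by rw [Int.floor_eq_iff]; push_cast; exact ⟨hz0, by linarith⟩
    have v0 : f Z = 0 := hf _ (Or.inr (Or.inl (by linarith)))
    have v2 : f (Z - EuclideanSpace.single 1 (1 : ℝ)) = 0 := hf _ (Or.inr (Or.inl (by rw [c10]; linarith)))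
    rcases lt_or_ge (Z 1) 1 with hz1 | hz1
    · have f1 : ⌊Z 1⌋ = 0 := Int.floor_eq_zero_iff.2 ⟨h1, hz1⟩
      have v3 : f (Z - EuclideanSpace.single 0 (1 : ℝ) - EuclideanSpace.single 1 (1 : ℝ)) = 0 :=
        hf _ (Or.inr (Or.inr (Or.inl (by rw [c21]; linarith))))
      rw [v0, v2, v3, f0, f1]
      simp
    · have f1 : ⌊Z 1⌋ = 1 := by rw [Int.floor_eq_iff]; push_cast; exact ⟨hz1, by linarith⟩
      have v1 : f (Z - EuclideanSpace.single 0 (1 : ℝ)) = 0 :=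
        hf _ (Or.inr (Or.inr (Or.inr (by rw [c01]; linarith))))
      rw [v0, v1, v2, f0, f1]
      simp [sub_sub]

/-- **The four half-scale children.**  `Σ_{n ∈ {0, e₀, e₁, e₀+e₁}} f (2 • T X - n) = f (T (2 • X))`: the folding
lemma at `Z = 2 • T X` (coordinates in `[0, 2)`), and `T (2 • T X) = T (2 • X)` since `2 • T X` and `2 • X` differ
by an integer horizontal translation. -/
theorem cellPeriodize_children {α : Type*} [AddMonoid α] (f : EuclideanSpace ℝ (Fin 3) → α) {m : ℝ} (hm : 0 ≤ m)
    (hf : ∀ Y : EuclideanSpace ℝ (Fin 3), (Y 0 ≤ m ∨ 1 - m ≤ Y 0 ∨ Y 1 ≤ m ∨ 1 - m ≤ Y 1) → f Y = 0)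
    (X : EuclideanSpace ℝ (Fin 3)) :
    f ((2 : ℝ) • T X) + f ((2 : ℝ) • T X - EuclideanSpace.single 0 (1 : ℝ)) +
        f ((2 : ℝ) • T X - EuclideanSpace.single 1 (1 : ℝ)) +
        f ((2 : ℝ) • T X - EuclideanSpace.single 0 (1 : ℝ) - EuclideanSpace.single 1 (1 : ℝ)) =
      f (T ((2 : ℝ) • X)) := by
  have hX0 := Int.floor_le (X 0)
  have hX0' := Int.lt_floor_add_one (X 0)
  have hX1 := Int.floor_le (X 1)
  have hX1' := Int.lt_floor_add_one (X 1)
  have e0 : ((2 : ℝ) • T X) 0 = 2 * (X 0 - ⌊X 0⌋) := by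
    rw [PiLp.smul_apply, smul_eq_mul, hT X, (cellPeriodize_coord _ _ _).1]
  have e1 : ((2 : ℝ) • T X) 1 = 2 * (X 1 - ⌊X 1⌋) := by
    rw [PiLp.smul_apply, smul_eq_mul, hT X, (cellPeriodize_coord _ _ _).2.1]
  -- `2 • T X` is an integer horizontal translate of `2 • X`
  have h2 : (2 : ℝ) • T X = (2 : ℝ) • X + (((-(2 * ⌊X 0⌋) : ℤ) : ℝ) • EuclideanSpace.single 0 (1 : ℝ) +
      ((-(2 * ⌊X 1⌋) : ℤ) : ℝ) • EuclideanSpace.single 1 (1 : ℝ)) := by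
    rw [hT X]
    push_cast
    module
  rw [cellPeriodize_fold hT f hm hf (by rw [e0]; linarith) (by rw [e0]; linarith) (by rw [e1]; linarith)
    (by rw [e1]; linarith), h2, cellPeriodize_shift hT]

end Periodize

/-! ### The registered stub -/

/-- **Stub `stub_localJunctionTransfer` (line `bernoulli-surface-topology`, TOOL stub; registered): the
`ℤ²`-periodization of a local junction in rest fluid is a periodic cell junction.**  Witnesses `g ∘ T`, `pg ∘ T`,
`u ∘ T`, `p ∘ T` (`T X = X - ⌊X₀⌋ e₀ - ⌊X₁⌋ e₁`) with the same `F, η`; smoothness, divergence and Euler by the local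
form (`cellPeriodize_contDiffAt`, `cellPeriodize_fderiv`), periodicity by `cellPeriodize_shift`, the flux clauses by
`cellPeriodize_trace`, the top collar verbatim at `T X` and the bottom collar by `cellPeriodize_children`. -/
theorem stub_localJunctionTransfer :
    (∃ (g : EuclideanSpace ℝ (Fin 3) → EuclideanSpace ℝ (Fin 3)) (pg : EuclideanSpace ℝ (Fin 3) → ℝ)
        (u : EuclideanSpace ℝ (Fin 3) → EuclideanSpace ℝ (Fin 3)) (p : EuclideanSpace ℝ (Fin 3) → ℝ) (F η δ : ℝ),
      ContDiff ℝ ((⊤ : ℕ∞) : WithTop ℕ∞) g ∧ ContDiff ℝ ((⊤ : ℕ∞) : WithTop ℕ∞) pg ∧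
      (∀ X : EuclideanSpace ℝ (Fin 3), ∑ i : Fin 3, (fderiv ℝ g X (EuclideanSpace.single i (1 : ℝ))) i = 0) ∧
      (∀ X : EuclideanSpace ℝ (Fin 3), (fderiv ℝ g X) (g X) + gradient pg X = 0) ∧
      0 < δ ∧ δ < 1 / 4 ∧
      (∀ X : EuclideanSpace ℝ (Fin 3), (X 0 ≤ 2 * δ ∨ 1 - 2 * δ ≤ X 0 ∨ X 1 ≤ 2 * δ ∨ 1 - 2 * δ ≤ X 1) →
        g X = 0 ∧ pg X = 0) ∧
      (∫ q in Set.Icc (0 : ℝ) 1 ×ˢ Set.Icc (0 : ℝ) 1, (g !₂[q.1, q.2, (0 : ℝ)]) 2 = 0) ∧ F ≠ 0 ∧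
      (∫ q in Set.Icc (0 : ℝ) 1 ×ˢ Set.Icc (0 : ℝ) 1,
        (g !₂[q.1, q.2, (0 : ℝ)]) 2 * (‖g !₂[q.1, q.2, (0 : ℝ)]‖ ^ 2 / 2 + pg !₂[q.1, q.2, (0 : ℝ)]) = F) ∧
      0 < η ∧ η < 1 / 2 ∧
      ContDiffOn ℝ ((⊤ : ℕ∞) : WithTop ℕ∞) u {Y : EuclideanSpace ℝ (Fin 3) | 1 - η < Y 2 ∧ Y 2 < 2 + η} ∧
      ContDiffOn ℝ ((⊤ : ℕ∞) : WithTop ℕ∞) p {Y : EuclideanSpace ℝ (Fin 3) | 1 - η < Y 2 ∧ Y 2 < 2 + η} ∧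
      (∀ X : EuclideanSpace ℝ (Fin 3), 1 < X 2 → X 2 < 2 →
        ∑ i : Fin 3, (fderiv ℝ u X (EuclideanSpace.single i (1 : ℝ))) i = 0) ∧
      (∀ X : EuclideanSpace ℝ (Fin 3), 1 < X 2 → X 2 < 2 → (fderiv ℝ u X) (u X) + gradient p X = 0) ∧
      (∀ X : EuclideanSpace ℝ (Fin 3), 1 - η < X 2 → X 2 < 2 + η →
        (X 0 ≤ δ ∨ 1 - δ ≤ X 0 ∨ X 1 ≤ δ ∨ 1 - δ ≤ X 1) → u X = 0 ∧ p X = 0) ∧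
      (∀ X : EuclideanSpace ℝ (Fin 3), 2 - η < X 2 → X 2 < 2 + η → u X = g X ∧ p X = pg X) ∧
      (∀ X : EuclideanSpace ℝ (Fin 3), 1 - η < X 2 → X 2 < 1 + η →
        u X = g ((2 : ℝ) • X) + g ((2 : ℝ) • X - EuclideanSpace.single 0 (1 : ℝ)) +
            g ((2 : ℝ) • X - EuclideanSpace.single 1 (1 : ℝ)) +
            g ((2 : ℝ) • X - EuclideanSpace.single 0 (1 : ℝ) - EuclideanSpace.single 1 (1 : ℝ)) ∧
          p X = pg ((2 : ℝ) • X) + pg ((2 : ℝ) • X - EuclideanSpace.single 0 (1 : ℝ)) +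
            pg ((2 : ℝ) • X - EuclideanSpace.single 1 (1 : ℝ)) +
            pg ((2 : ℝ) • X - EuclideanSpace.single 0 (1 : ℝ) - EuclideanSpace.single 1 (1 : ℝ)))) →
    ∃ (G : EuclideanSpace ℝ (Fin 3) → EuclideanSpace ℝ (Fin 3)) (PG : EuclideanSpace ℝ (Fin 3) → ℝ)
        (U : EuclideanSpace ℝ (Fin 3) → EuclideanSpace ℝ (Fin 3)) (P : EuclideanSpace ℝ (Fin 3) → ℝ) (F η : ℝ),
      ContDiff ℝ ((⊤ : ℕ∞) : WithTop ℕ∞) G ∧ ContDiff ℝ ((⊤ : ℕ∞) : WithTop ℕ∞) PG ∧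
      (∀ X : EuclideanSpace ℝ (Fin 3), ∑ i : Fin 3, (fderiv ℝ G X (EuclideanSpace.single i (1 : ℝ))) i = 0) ∧
      (∀ X : EuclideanSpace ℝ (Fin 3), (fderiv ℝ G X) (G X) + gradient PG X = 0) ∧
      (∀ X : EuclideanSpace ℝ (Fin 3),
        G (X + EuclideanSpace.single 0 (1 : ℝ)) = G X ∧ G (X + EuclideanSpace.single 1 (1 : ℝ)) = G X ∧
        PG (X + EuclideanSpace.single 0 (1 : ℝ)) = PG X ∧ PG (X + EuclideanSpace.single 1 (1 : ℝ)) = PG X) ∧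
      (∫ q in Set.Icc (0 : ℝ) 1 ×ˢ Set.Icc (0 : ℝ) 1, (G !₂[q.1, q.2, (0 : ℝ)]) 2 = 0) ∧ F ≠ 0 ∧
      (∫ q in Set.Icc (0 : ℝ) 1 ×ˢ Set.Icc (0 : ℝ) 1,
        (G !₂[q.1, q.2, (0 : ℝ)]) 2 * (‖G !₂[q.1, q.2, (0 : ℝ)]‖ ^ 2 / 2 + PG !₂[q.1, q.2, (0 : ℝ)]) = F) ∧
      0 < η ∧ η < 1 / 2 ∧
      ContDiffOn ℝ ((⊤ : ℕ∞) : WithTop ℕ∞) U {Y : EuclideanSpace ℝ (Fin 3) | 1 - η < Y 2 ∧ Y 2 < 2 + η} ∧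
      ContDiffOn ℝ ((⊤ : ℕ∞) : WithTop ℕ∞) P {Y : EuclideanSpace ℝ (Fin 3) | 1 - η < Y 2 ∧ Y 2 < 2 + η} ∧
      (∀ X : EuclideanSpace ℝ (Fin 3), 1 < X 2 → X 2 < 2 →
        ∑ i : Fin 3, (fderiv ℝ U X (EuclideanSpace.single i (1 : ℝ))) i = 0) ∧
      (∀ X : EuclideanSpace ℝ (Fin 3), 1 < X 2 → X 2 < 2 → (fderiv ℝ U X) (U X) + gradient P X = 0) ∧
      (∀ X : EuclideanSpace ℝ (Fin 3), 1 ≤ X 2 → X 2 ≤ 2 →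
        U (X + EuclideanSpace.single 0 (1 : ℝ)) = U X ∧ U (X + EuclideanSpace.single 1 (1 : ℝ)) = U X ∧
        P (X + EuclideanSpace.single 0 (1 : ℝ)) = P X ∧ P (X + EuclideanSpace.single 1 (1 : ℝ)) = P X) ∧
      (∀ X : EuclideanSpace ℝ (Fin 3), 2 - η < X 2 → X 2 < 2 + η → U X = G X ∧ P X = PG X) ∧
      (∀ X : EuclideanSpace ℝ (Fin 3), 1 - η < X 2 → X 2 < 1 + η →
        U X = G ((2 : ℝ) • X) ∧ P X = PG ((2 : ℝ) • X)) := by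
  rintro ⟨g, pg, u, p, F, η, δ, hg, hpg, hdiv, hE, hδ, -, hmg, hmass, hF, hflux, hη, hη2, hu, hp, hudiv, huE,
    hmu, htop, hbot⟩
  -- the reduction into the unit column, as an abstract map with its defining identity
  obtain ⟨T, hT⟩ : ∃ T : EuclideanSpace ℝ (Fin 3) → EuclideanSpace ℝ (Fin 3), ∀ X : EuclideanSpace ℝ (Fin 3),
      T X = X - ((⌊X 0⌋ : ℝ) • EuclideanSpace.single 0 (1 : ℝ) + (⌊X 1⌋ : ℝ) • EuclideanSpace.single 1 (1 : ℝ)) :=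
    ⟨_, fun X => rfl⟩
  have h2δ : (0 : ℝ) < 2 * δ := by linarith
  -- the margins, in the forms consumed by the helpers
  have hg0' : ∀ Y : EuclideanSpace ℝ (Fin 3),
      (Y 0 ≤ 2 * δ ∨ 1 - 2 * δ ≤ Y 0 ∨ Y 1 ≤ 2 * δ ∨ 1 - 2 * δ ≤ Y 1) → g Y = 0 := fun Y h => (hmg Y h).1
  have hpg0' : ∀ Y : EuclideanSpace ℝ (Fin 3),
      (Y 0 ≤ 2 * δ ∨ 1 - 2 * δ ≤ Y 0 ∨ Y 1 ≤ 2 * δ ∨ 1 - 2 * δ ≤ Y 1) → pg Y = 0 := fun Y h => (hmg Y h).2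
  have hg0 := fun (Y : EuclideanSpace ℝ (Fin 3)) (_ : Y 2 ∈ (univ : Set ℝ)) h => hg0' Y h
  have hpg0 := fun (Y : EuclideanSpace ℝ (Fin 3)) (_ : Y 2 ∈ (univ : Set ℝ)) h => hpg0' Y h
  have hu0 := fun (Y : EuclideanSpace ℝ (Fin 3)) (hY : Y 2 ∈ Ioo (1 - η) (2 + η))
    (h : Y 0 ≤ δ ∨ 1 - δ ≤ Y 0 ∨ Y 1 ≤ δ ∨ 1 - δ ≤ Y 1) => (hmu Y hY.1 hY.2 h).1
  have hp0 := fun (Y : EuclideanSpace ℝ (Fin 3)) (hY : Y 2 ∈ Ioo (1 - η) (2 + η))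
    (h : Y 0 ≤ δ ∨ 1 - δ ≤ Y 0 ∨ Y 1 ≤ δ ∨ 1 - δ ≤ Y 1) => (hmu Y hY.1 hY.2 h).2
  -- heights are preserved by `T`; `T` is `ℤ²`-periodic
  have hT2 : ∀ X : EuclideanSpace ℝ (Fin 3), T X 2 = X 2 := fun X => by
    rw [hT X]
    exact (cellPeriodize_coord _ _ _).2.2
  have hP0 : ∀ X : EuclideanSpace ℝ (Fin 3), T (X + EuclideanSpace.single 0 (1 : ℝ)) = T X := fun X => by
    simpa using cellPeriodize_shift hT X 1 0
  have hP1 : ∀ X : EuclideanSpace ℝ (Fin 3), T (X + EuclideanSpace.single 1 (1 : ℝ)) = T X := fun X => by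
    simpa using cellPeriodize_shift hT X 0 1
  refine ⟨fun X => g (T X), fun X => pg (T X), fun X => u (T X), fun X => p (T X), F, η, ?_⟩
  dsimp only
  refine ⟨?_, ?_, ?_, ?_, fun X => ?_, ?_, hF, ?_, hη, hη2, fun X hX => ?_, fun X hX => ?_, fun X h1 h2 => ?_,
    fun X h1 h2 => ?_, fun X _ _ => ?_, fun X h1 h2 => ?_, fun X h1 h2 => ?_⟩
  · -- `G` is smooth
    exact contDiff_iff_contDiffAt.2 fun X => cellPeriodize_contDiffAt hT g isOpen_univ h2δ hg0 (mem_univ _) hg.contDiffAt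
  · -- `PG` is smooth
    exact contDiff_iff_contDiffAt.2 fun X =>
      cellPeriodize_contDiffAt hT pg isOpen_univ h2δ hpg0 (mem_univ _) hpg.contDiffAt
  · -- `G` is divergence free
    intro X
    rw [cellPeriodize_fderiv hT g isOpen_univ h2δ hg0 (mem_univ _)]
    exact hdiv _
  · -- steady Euler for `(G, PG)`
    intro X
    unfold gradient
    rw [cellPeriodize_fderiv hT g isOpen_univ h2δ hg0 (mem_univ _),
      cellPeriodize_fderiv hT pg isOpen_univ h2δ hpg0 (mem_univ _)]
    exact hE _
  · -- `ℤ²`-periodicity of `(G, PG)`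
    rw [hP0, hP1]
    exact ⟨rfl, rfl, rfl, rfl⟩
  · -- zero mass flux: the trace on the unit square is that of `g`
    refine Eq.trans (setIntegral_congr_fun (measurableSet_Icc.prod measurableSet_Icc) fun q hq => ?_) hmass
    simp only [cellPeriodize_trace hT g h2δ.le hg0' hq.1 hq.2]
  · -- the energy flux is `F`
    refine Eq.trans (setIntegral_congr_fun (measurableSet_Icc.prod measurableSet_Icc) fun q hq => ?_) hflux
    simp only [cellPeriodize_trace hT g h2δ.le hg0' hq.1 hq.2, cellPeriodize_trace hT pg h2δ.le hpg0' hq.1 hq.2]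
  · -- `U` is smooth on the slab
    exact (cellPeriodize_contDiffAt hT u isOpen_Ioo hδ hu0 hX (hu.contDiffAt
      ((slabExt_isOpen_band _ _).mem_nhds (by rw [mem_setOf_eq, hT2]; exact hX)))).contDiffWithinAt
  · -- `P` is smooth on the slab
    exact (cellPeriodize_contDiffAt hT p isOpen_Ioo hδ hp0 hX (hp.contDiffAt
      ((slabExt_isOpen_band _ _).mem_nhds (by rw [mem_setOf_eq, hT2]; exact hX)))).contDiffWithinAt
  · -- `U` is divergence free on the open band
    rw [cellPeriodize_fderiv hT u isOpen_Ioo hδ hu0 (show X 2 ∈ Ioo (1 - η) (2 + η) from ⟨by linarith, by linarith⟩)]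
    exact hudiv _ (by rw [hT2]; exact h1) (by rw [hT2]; exact h2)
  · -- steady Euler for `(U, P)` on the open band
    have hX : X 2 ∈ Ioo (1 - η) (2 + η) := ⟨by linarith, by linarith⟩
    unfold gradient
    rw [cellPeriodize_fderiv hT u isOpen_Ioo hδ hu0 hX, cellPeriodize_fderiv hT p isOpen_Ioo hδ hp0 hX]
    exact huE _ (by rw [hT2]; exact h1) (by rw [hT2]; exact h2)
  · -- `ℤ²`-periodicity of `(U, P)` (it holds everywhere)
    rw [hP0, hP1]
    exact ⟨rfl, rfl, rfl, rfl⟩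
  · -- top collar: verbatim at `T X` (same height)
    exact htop _ (by rw [hT2]; exact h1) (by rw [hT2]; exact h2)
  · -- bottom collar: the four children of `g`, `pg` at `T X` fold into `G (2 • X)`, `PG (2 • X)`
    obtain ⟨hbu, hbp⟩ := hbot (T X) (by rw [hT2]; exact h1) (by rw [hT2]; exact h2)
    rw [hbu, hbp, cellPeriodize_children hT g h2δ.le hg0' X, cellPeriodize_children hT pg h2δ.le hpg0' X]
    exact ⟨rfl, rfl⟩

end Summit.AnomalousDissipation.AnomalousDissipation.Theorems.HalfSpaceHierarchy

end
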